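import Literature.NumberTheory.LFunctions.Zhang2022.DetectorShiftAdmissible

/-!
# Zhang (2022), programme F-S3 (cell landau-siegel §E, seat ls-barrier-num): the leading coefficient
# `c₀(b) = Re Σ_j W_j(b)` of the shift-triple recipe is POSITIVE for every sign-admissible triple

Y. Zhang, *Discrete mean estimates and the Landau–Siegel zero*, arXiv:2211.02515v1 [Zhang2022LandauSiegel] —
an unrefereed manuscript under adjudication. **WHAT THIS IS NOT: not a claim about Theorems 1–2 of
arXiv:2211.02515, about Landau–Siegel zeros, or about Parity; nothing here asserts any claim of the manuscript.
The programme SEARCHES and TYPES; no claim about Landau–Siegel zeros, Theorems 1–2 of arXiv:2211.02515 or a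
repaired Margin232 until a kernel theorem says so.**

For the candidate three-channel recipe `Det.shiftRecipe b` (weights `Det.shiftW b j = b_j e^{iπ(s_j−b_j)/2}/v_j`,
`DetectorMainTermForm`, registry E-010) the one-sided main-term form `𝔅_b = Det.FormDet (shiftRecipe b)` has the
pointwise integrand `Det.pwForm` (`DetectorRecipeCertificate`) whose `|g′|²`-coefficient is `(2/π)·c₀(b)`,
`c₀(b) := Re Σ_j W_j(b)` — the leading coefficient of the bulk symbol `c₀π⁴η(η+b₁)(η+b₂)(η+b₃)` of `𝔅_b`
(cell memo barrier/num/SHIFT-PSD.md §0.2) and the pivot of every LQ certificate of `Det.FormDetPSD (shiftRecipe b)`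
(`Det.formDetPSD_of_certificate`; instances `Det.formDetPSD_shiftRecipe_bStar`, `…_bStar2`). Criterion (C1) of
that memo is `c₀(b) > 0`. This file proves it for the WHOLE sign-admissible family (`Det.SignAdmissible`,
Lemma 2.3's box: `0 < b₀ < b₁ < b₂`, `b₀ ≤ 1`, `[b₁, b₂] ⊂ [k, k+1]`):

* `shiftW_re` — `Re W_j(b) = b_j cos(π(s_j − b_j)/2)/v_j`;
* `re_sum_shiftW_eq` — the CLOSED FORM (cell memo barrier/num/H-CLOSED-FORM.md, Id-1, there obtained by computer
  algebra and here PROVED): for pairwise distinct `b`,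
  `Re Σ_j W_j(b) = (2/(b₁−b₀))·[ b₁ sin(πb₀/2) sin(π(b₂−b₁)/2)/(b₂−b₁) − b₀ sin(πb₁/2) sin(π(b₂−b₀)/2)/(b₂−b₀) ]`
  (product-to-sum and coefficient matching — pure trigonometry);
* (private) `halfSinc_strictAntiOn` — `x ↦ sin(πx/2)/x` is strictly decreasing on `(0, 2)` (`x < tan x`);
* **`re_sum_shiftW_pos`** — `0 < Re Σ_j W_j(b)` for every sign-admissible `b`: for gap index `k ≥ 2` by
  `sin(πx/2) ≥ x` on `[0,1]` (Jordan) and `|sin| ≤ 1`; for `k ≤ 1` by the monotonicity of `sin(πx/2)/x` on `(0,2)`;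
  `re_sum_shiftRecipe_W_pos` restates it for `(shiftRecipe b).W`.

So the `|g′|²`-pivot of the LQ certificate format is available at EVERY admissible detector, not only at the typed
instances; equivalently the bulk form of `𝔅_b` is bounded below (elliptic) class-wide. This is the (C1) third of the
memo's index argument for the E-010 slot on the whole family; (C3) (`det` of the AFE-plane Gram) and the spectral-flow
step are NOT here. Elementary real analysis; standard axioms; no numerics.

References: Y. Zhang, arXiv:2211.02515v1 (2022), §2 Lemma 2.3 and (2.13) [p. 9]; Prop. 7.1 and its proof,
(7.19)–(7.21) [pp. 44–47]. [cite: Zhang2022LandauSiegel, §2 Lemma 2.3; proof of Prop 7.1 (7.19)–(7.21)]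
-/

noncomputable section

open Complex Real Set

namespace Literature.NumberTheory.LFunctions.Zhang2022

namespace Det

/-! ### Part 1 — the real part of the total channel weight in closed form -/

/-- `Re W_j(b) = b_j·cos(π(s_j − b_j)/2)/v_j` (the weight's modulus-phase form; `v_j = Π_{i≠j}(b_i − b_j)`).
[cite: Zhang2022LandauSiegel, proof of Prop 7.1, (7.19)–(7.21)] -/
theorem shiftW_re (b : Fin 3 → ℝ) (j : Fin 3) :
    (shiftW b j).re = b j * Real.cos (π * ((shiftS b j - b j) / 2)) / shiftVdm b j := by
  have h : I * (π : ℂ) * (((shiftS b j - b j) / 2 : ℝ) : ℂ) = ((π * ((shiftS b j - b j) / 2) : ℝ) : ℂ) * I := by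
    push_cast; ring
  rw [shiftW, h, Complex.div_ofReal_re, Complex.re_ofReal_mul, Complex.exp_ofReal_mul_I_re]

/-- **Closed form of `c₀(b) = Re Σ_j W_j(b)`** for a pairwise-distinct triple (cell memo H-CLOSED-FORM.md, Id-1):
`Re Σ_j W_j(b) = (2/(b₁−b₀))·[ b₁ sin(πb₀/2) sin(π(b₂−b₁)/2)/(b₂−b₁) − b₀ sin(πb₁/2) sin(π(b₂−b₀)/2)/(b₂−b₀) ]`.
Proof: `Re W_j = b_j cos(πα_j/2)/v_j` with `α_j = s_j − b_j`; `2 sin x sin y = cos(x−y) − cos(x+y)` turns the right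
side into the same three cosines, and the coefficients agree. [cite: Zhang2022LandauSiegel, proof of Prop 7.1, (7.19)–(7.21)] -/
theorem re_sum_shiftW_eq (b : Fin 3 → ℝ) (h01 : b 0 ≠ b 1) (h02 : b 0 ≠ b 2) (h12 : b 1 ≠ b 2) :
    (∑ j : Fin 3, shiftW b j).re =
      2 / (b 1 - b 0) *
        (b 1 * (Real.sin (π / 2 * b 0) * Real.sin (π / 2 * (b 2 - b 1))) / (b 2 - b 1)
          - b 0 * (Real.sin (π / 2 * b 1) * Real.sin (π / 2 * (b 2 - b 0))) / (b 2 - b 0)) := by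
  rw [Complex.re_sum, Fin.sum_univ_three, shiftW_re, shiftW_re, shiftW_re]
  simp only [shiftS, shiftVdm, Matrix.cons_val_zero, Matrix.cons_val_one, Matrix.head_cons,
    Matrix.cons_val_two, Matrix.tail_cons]
  -- the three cosines
  set A0 := Real.cos (π * ((b 1 + b 2 - b 0) / 2)) with hA0
  set A1 := Real.cos (π * ((b 2 + b 0 - b 1) / 2)) with hA1
  set A2 := Real.cos (π * ((b 0 + b 1 - b 2) / 2)) with hA2
  have e1 : Real.sin (π / 2 * b 0) * Real.sin (π / 2 * (b 2 - b 1)) = (A2 - A1) / 2 := by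
    have h := Real.two_mul_sin_mul_sin (π / 2 * b 0) (π / 2 * (b 2 - b 1))
    rw [show π / 2 * b 0 - π / 2 * (b 2 - b 1) = π * ((b 0 + b 1 - b 2) / 2) by ring,
      show π / 2 * b 0 + π / 2 * (b 2 - b 1) = π * ((b 2 + b 0 - b 1) / 2) by ring] at h
    rw [hA2, hA1]; linarith
  have e2 : Real.sin (π / 2 * b 1) * Real.sin (π / 2 * (b 2 - b 0)) = (A2 - A0) / 2 := by
    have h := Real.two_mul_sin_mul_sin (π / 2 * b 1) (π / 2 * (b 2 - b 0))
    rw [show π / 2 * b 1 - π / 2 * (b 2 - b 0) = π * ((b 0 + b 1 - b 2) / 2) by ring,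
      show π / 2 * b 1 + π / 2 * (b 2 - b 0) = π * ((b 1 + b 2 - b 0) / 2) by ring] at h
    rw [hA2, hA0]; linarith
  rw [e1, e2]
  have d10 : b 1 - b 0 ≠ 0 := sub_ne_zero.2 (Ne.symm h01)
  have d20 : b 2 - b 0 ≠ 0 := sub_ne_zero.2 (Ne.symm h02)
  have d21 : b 2 - b 1 ≠ 0 := sub_ne_zero.2 (Ne.symm h12)
  have d01 : b 0 - b 1 ≠ 0 := sub_ne_zero.2 h01
  have d02 : b 0 - b 2 ≠ 0 := sub_ne_zero.2 h02
  have d12 : b 1 - b 2 ≠ 0 := sub_ne_zero.2 h12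
  field_simp
  ring

/-! ### Part 2 — two elementary facts about `sin(πx/2)` -/

/-- Jordan's inequality in the form `x ≤ sin(πx/2)` for `0 ≤ x ≤ 1`. [folklore] -/
private theorem le_sin_pi_div_two_mul {x : ℝ} (h0 : 0 ≤ x) (h1 : x ≤ 1) : x ≤ Real.sin (π / 2 * x) := by
  have hx : 0 ≤ π / 2 * x := by positivity
  have hx' : π / 2 * x ≤ π / 2 := by nlinarith [Real.pi_pos]
  have h := Real.mul_le_sin hx hx'
  have hπ : π ≠ 0 := Real.pi_ne_zero
  calc x = 2 / π * (π / 2 * x) := by field_simp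
    _ ≤ Real.sin (π / 2 * x) := h

/-- `θ·cos θ < sin θ` for `0 < θ < π` (from `θ < tan θ` on `(0, π/2)`, and signs beyond). [folklore] -/
private theorem mul_cos_lt_sin {θ : ℝ} (h0 : 0 < θ) (hπ : θ < π) : θ * Real.cos θ < Real.sin θ := by
  have hsin : 0 < Real.sin θ := Real.sin_pos_of_pos_of_lt_pi h0 hπ
  rcases lt_trichotomy θ (π / 2) with hlt | heq | hgt
  · have hcos : 0 < Real.cos θ := Real.cos_pos_of_mem_Ioo ⟨by linarith, hlt⟩
    have ht := Real.lt_tan h0 hlt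
    rw [Real.tan_eq_sin_div_cos, lt_div_iff₀ hcos] at ht
    exact ht
  · rw [heq, Real.cos_pi_div_two, mul_zero]; exact Real.sin_pi_div_two ▸ one_pos
  · have hcos : Real.cos θ < 0 := Real.cos_neg_of_pi_div_two_lt_of_lt hgt (by linarith)
    nlinarith

/-- **`x ↦ sin(πx/2)/x` is strictly decreasing on `(0, 2)`.** [folklore] -/
private theorem halfSinc_strictAntiOn :
    StrictAntiOn (fun x : ℝ => Real.sin (π / 2 * x) / x) (Ioo (0 : ℝ) 2) := by
  have hder : ∀ x ∈ Ioo (0 : ℝ) 2,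
      HasDerivAt (fun x : ℝ => Real.sin (π / 2 * x) / x)
        ((Real.cos (π / 2 * x) * (π / 2 * 1) * x - Real.sin (π / 2 * x) * 1) / x ^ 2) x := by
    intro x hx
    have h1 : HasDerivAt (fun x : ℝ => Real.sin (π / 2 * x)) (Real.cos (π / 2 * x) * (π / 2 * 1)) x :=
      ((hasDerivAt_id' x).const_mul (π / 2)).sin
    exact h1.div (hasDerivAt_id' x) (ne_of_gt hx.1)
  refine strictAntiOn_of_deriv_neg (convex_Ioo 0 2) ?_ ?_
  · exact fun x hx => (hder x hx).continuousAt.continuousWithinAt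
  · intro x hx
    rw [interior_Ioo] at hx
    rw [(hder x hx).deriv]
    have hxpos : 0 < x := hx.1
    have hθ0 : 0 < π / 2 * x := by positivity
    have hθπ : π / 2 * x < π := by nlinarith [Real.pi_pos, hx.2]
    have key := mul_cos_lt_sin hθ0 hθπ
    apply div_neg_of_neg_of_pos _ (by positivity)
    nlinarith

/-! ### Part 3 — positivity of `c₀(b)` on the sign-admissible family -/

/-- **(C1) on the whole family: `0 < Re Σ_j W_j(b)` for every sign-admissible shift triple `b`.**
Case `k ≥ 2`: `sin(πb₀/2)/b₀ ≥ 1`, `sin(π(b₂−b₁)/2)/(b₂−b₁) ≥ 1` (Jordan) while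
`|sin(πb₁/2)/b₁ · sin(π(b₂−b₀)/2)/(b₂−b₀)| ≤ 1/(b₁(b₂−b₀)) ≤ 1/2`. Case `k ≤ 1`: all four arguments lie in
`(0, 2)`, where `sin(πx/2)/x` is positive and strictly decreasing, and `b₀ < b₁`, `b₂ − b₁ < b₂ − b₀`.
[cite: Zhang2022LandauSiegel, §2 Lemma 2.3; proof of Prop 7.1 (7.19)–(7.21)] -/
theorem re_sum_shiftW_pos {b : Fin 3 → ℝ} (hb : SignAdmissible b) : 0 < (∑ j : Fin 3, shiftW b j).re := by
  obtain ⟨h0, h01, h12, hle1, k, hk1, hk2⟩ := hb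
  have h02 : b 0 < b 2 := h01.trans h12
  rw [re_sum_shiftW_eq b h01.ne h02.ne h12.ne]
  have d10 : 0 < b 1 - b 0 := sub_pos.2 h01
  have d21 : 0 < b 2 - b 1 := sub_pos.2 h12
  have d20 : 0 < b 2 - b 0 := sub_pos.2 h02
  have hb1 : 0 < b 1 := h0.trans h01
  -- abbreviations: the four sinc values
  set q0 := Real.sin (π / 2 * b 0) / b 0 with hq0
  set qD := Real.sin (π / 2 * (b 2 - b 1)) / (b 2 - b 1) with hqD
  set q1 := Real.sin (π / 2 * b 1) / b 1 with hq1
  set qE := Real.sin (π / 2 * (b 2 - b 0)) / (b 2 - b 0) with hqE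
  -- rewrite the bracket as b₀b₁(q0·qD − q1·qE)
  have hrew : b 1 * (Real.sin (π / 2 * b 0) * Real.sin (π / 2 * (b 2 - b 1))) / (b 2 - b 1)
      - b 0 * (Real.sin (π / 2 * b 1) * Real.sin (π / 2 * (b 2 - b 0))) / (b 2 - b 0)
      = b 0 * b 1 * (q0 * qD - q1 * qE) := by
    rw [hq0, hqD, hq1, hqE]
    field_simp
  rw [hrew]
  have hΔle1 : b 2 - b 1 ≤ 1 := by
    have : (k : ℝ) ≤ b 1 := hk1
    linarith
  -- the bracket is positive
  have hbr : 0 < q0 * qD - q1 * qE := by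
    rcases Nat.lt_or_ge k 2 with hk | hk
    · -- k ≤ 1: everything in (0,2), use strict monotonicity
      have hb1lt2 : b 1 < 2 := by
        have : (k : ℝ) ≤ 1 := by exact_mod_cast Nat.lt_succ_iff.mp hk
        linarith
      have hb2le2 : b 2 ≤ 2 := by
        have : (k : ℝ) ≤ 1 := by exact_mod_cast Nat.lt_succ_iff.mp hk
        linarith
      have m0 : b 0 ∈ Ioo (0:ℝ) 2 := ⟨h0, by linarith⟩
      have m1 : b 1 ∈ Ioo (0:ℝ) 2 := ⟨hb1, hb1lt2⟩
      have mD : b 2 - b 1 ∈ Ioo (0:ℝ) 2 := ⟨d21, by linarith⟩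
      have mE : b 2 - b 0 ∈ Ioo (0:ℝ) 2 := ⟨d20, by linarith⟩
      have hq01 : q1 < q0 := halfSinc_strictAntiOn m0 m1 h01
      have hqDE : qE < qD := halfSinc_strictAntiOn mD mE (by linarith)
      -- positivity of q1 and qE (sin > 0 on (0,π))
      have hq1pos : 0 < q1 := by
        rw [hq1]; apply div_pos _ hb1
        exact Real.sin_pos_of_pos_of_lt_pi (by positivity) (by nlinarith [Real.pi_pos])
      have hqEpos : 0 < qE := by
        rw [hqE]; apply div_pos _ d20
        exact Real.sin_pos_of_pos_of_lt_pi (by positivity) (by nlinarith [Real.pi_pos])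
      have hqDpos : 0 < qD := hqEpos.trans hqDE
      nlinarith [mul_pos (sub_pos.2 hq01) hqDpos, mul_pos hq1pos (sub_pos.2 hqDE)]
    · -- k ≥ 2
      have hk2 : (2:ℝ) ≤ k := by exact_mod_cast hk
      have hb1ge2 : 2 ≤ b 1 := hk2.trans hk1
      have hEge1 : 1 ≤ b 2 - b 0 := by linarith
      have hq0ge : 1 ≤ q0 := by
        rw [hq0, le_div_iff₀ h0, one_mul]; exact le_sin_pi_div_two_mul h0.le hle1
      have hqDge : 1 ≤ qD := by
        rw [hqD, le_div_iff₀ d21, one_mul]; exact le_sin_pi_div_two_mul d21.le hΔle1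
      have hq1abs : |q1| ≤ 1 / 2 := by
        rw [hq1, abs_div, abs_of_pos hb1]
        calc |Real.sin (π / 2 * b 1)| / b 1 ≤ 1 / b 1 := by
              gcongr; exact Real.abs_sin_le_one _
          _ ≤ 1 / 2 := by gcongr
      have hqEabs : |qE| ≤ 1 := by
        rw [hqE, abs_div, abs_of_pos d20]
        calc |Real.sin (π / 2 * (b 2 - b 0))| / (b 2 - b 0) ≤ 1 / (b 2 - b 0) := by
              gcongr; exact Real.abs_sin_le_one _
          _ ≤ 1 := by rw [div_le_one d20]; exact hEge1
      have hprod : |q1 * qE| ≤ 1 / 2 := by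
        rw [abs_mul]
        calc |q1| * |qE| ≤ (1 / 2) * 1 := mul_le_mul hq1abs hqEabs (abs_nonneg _) (by norm_num)
          _ = 1 / 2 := by norm_num
      have h1 : 1 ≤ q0 * qD := by nlinarith
      have h2 : q1 * qE ≤ 1 / 2 := (le_abs_self _).trans hprod
      linarith
  have : 0 < b 0 * b 1 * (q0 * qD - q1 * qE) := by positivity
  positivity

/-- The same statement for the recipe's weight field: `0 < Re Σ_j (shiftRecipe b).W j` — the `|g′|²`-pivot of the
LQ certificate format (`Det.pwForm`) is positive at every sign-admissible detector.
[cite: Zhang2022LandauSiegel, §2 Lemma 2.3; proof of Prop 7.1 (7.19)–(7.21)] -/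
theorem re_sum_shiftRecipe_W_pos {b : Fin 3 → ℝ} (hb : SignAdmissible b) :
    0 < (∑ j : Fin 3, (shiftRecipe b).W j).re := by
  simpa [shiftRecipe] using re_sum_shiftW_pos hb

/-- Control at the printed triple: `Re Σ_j W_j(1,2,3) = 4` (`W = (½, 2, 3/2)`, `shiftW_std`).
[cite: Zhang2022LandauSiegel, Prop 7.1 p.44] -/
theorem re_sum_shiftW_std : (∑ j : Fin 3, shiftW ![1, 2, 3] j).re = 4 := by
  rw [shiftW_std]
  simp [Fin.sum_univ_three]
  norm_num

end Det

end Literature.NumberTheory.LFunctions.Zhang2022
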